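import Literature.Probability.RandomPlanarGeometry.SAWTriangularBrickWalks
import HarnessLib

/-!
# Decoding a row-separated polygon join on the triangular lattice: the equal-split junction rhombus is unique

Topic `Literature/Probability/RandomPlanarGeometry` (lane «pcv-sawmu», a-p4 g9; stub S3𝕋 of the line «TRI-MADRAS»
`q_N(𝕋) ≤ A·N^{−1/2}·μ(𝕋)^N`, in the brick frame `brickGraph` of `SAWTriangularBrickWalks.lean`: sites `(X, Y) ∈ ℤ²`, steps `(±2, 0)`,
`(±1, ±1)`; rows = values of `Y`).

Context.  Madras' `√N`-gain join (N. Madras, J. Stat. Phys. 78 (1995) 681–699, §2; A. Hammond, arXiv:1504.05286v5 §4.1, Definition 4.3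
p. 20) glues a left polygon `P` and a right polygon `Q'` across one junction cell and must then DECODE the junction from the joined polygon
alone.  On `ℤ²` the tree does this with the parity lemma `SAW.JoinParity.uniqueInteriorEqNeck` (`SAWPolygonJoinParity.lean`, "at most one
equal-split join plaquette of odd ray parity").  Here is a shorter invariant that suffices for joins which are ROW-SEPARATED (in every row,
all sites of `P` lie strictly left of all sites of `Q'` — automatic for Madras' «slide until first contact» placement): read the joined
`2N`-gon as a `2N`-periodic sequence of brick sites `v` (consecutive sites adjacent); a ROW-SEPARATED EQUAL-SPLIT CUT at `j` says that the arc
`v[j, j+N)` is glued to the arc `v[j+N, j+2N)` across a rhombus — `v (j−1) = v j + (2,0)`, `v (j+N) = v (j+N−1) + (2,0)`,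
`v (j+N−1) = v j + (±1, ±1)` — and that the first arc lies row-wise strictly left of the second.  **Such a cut is unique** (`isRowSepCut_unique`):
two cuts would differ by arcs `A`, `B` lying in disjoint row intervals on the two sides of the junction rows, forcing both junctions onto the
same pair of rows, where the left/right order of the four junction sites is contradictory.  No self-avoidance, parity of cells or Jordan
curve argument is used — only that rows change by at most one per step and that `X + Y` is constant mod 2 along brick steps.

## What is proved (namespace `…SAW.TriPolygon`; all `theorem`s, axioms standard)

* `IsRowSepCut N v j` (the predicate above); `exists_row_eq` (discrete intermediate value property of the rows of a brick path),
  `isRowSepCut_shift` (re-rooting), `not_isRowSepCut_of_zero` (core case);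
* **`isRowSepCut_unique : IsRowSepCut N v j₁ → IsRowSepCut N v j₂ → j₁ = j₂`** for `j₁, j₂ < 2N`, `v` `2N`-periodic with adjacent
  consecutive sites.

Label (lit-2 g16, 2026-08-23): [cite: Hammond2015SAPJoining, Definition 4.3 and §4.2 (arXiv v5 pp. 20–24: junction plaquette; global join
plaquettes and their enumeration)] [cite: Madras1995LatticeAnimalsExponent, §2 (primary, not held)] [cite: MadrasSlade1993, Theorem 3.2.3 proof
(p. 64–65: extremal-bond decoding of polygon concatenation)] — the row-separation uniqueness invariant is not located in print — NEW-IN-WRITING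
(modest), technique class Madras join.
-/

noncomputable section

open Literature.Probability.LatticeModels

namespace Literature.Probability.RandomPlanarGeometry.SAW

namespace TriPolygon

variable {N : ℕ} {v : ℕ → Site 2}

/-- **Row-separated equal-split cut** of a `2N`-periodic site sequence `v` at `j`: the arc `v[j, j+N)` (left polygon, junction sites
`p = v j`, `u = v (j+N−1)`) and the arc `v[j+N, j+2N)` (right polygon, junction sites `q = v (j+2N−1) = p + (2,0)`, `w = v (j+N) = u + (2,0)`)
with `u − p ∈ {(±1, ±1)}` (the junction rhombus `p q w u`), the left arc lying strictly left of the right arc in every row.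
[cite: Hammond2015SAPJoining, Definition 4.3 (arXiv v5 p. 20: the Madras join polygon and its junction plaquette)] -/
def IsRowSepCut (N : ℕ) (v : ℕ → Site 2) (j : ℕ) : Prop :=
  (v (j + 2 * N - 1) 1 = v j 1 ∧ v (j + 2 * N - 1) 0 = v j 0 + 2) ∧
  (v (j + N) 1 = v (j + N - 1) 1 ∧ v (j + N) 0 = v (j + N - 1) 0 + 2) ∧
  ((v (j + N - 1) 1 = v j 1 + 1 ∨ v (j + N - 1) 1 + 1 = v j 1) ∧
    (v (j + N - 1) 0 = v j 0 + 1 ∨ v (j + N - 1) 0 + 1 = v j 0)) ∧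
  ∀ a b : ℕ, j ≤ a → a < j + N → j + N ≤ b → b < j + 2 * N → v a 1 = v b 1 → v a 0 < v b 0

/-! ### Brick paths: rows move by at most one, `X + Y` is constant mod 2 -/

/-- One brick step changes the row by at most one. [cite: Grimmett2018, §5.5 (brick coordinates of 𝕋)] -/
theorem row_step_le (hstep : ∀ i, brickGraph.Adj (v i) (v (i + 1))) (i : ℕ) :
    v (i + 1) 1 ≤ v i 1 + 1 ∧ v i 1 ≤ v (i + 1) 1 + 1 := by
  have h := (brickGraph_adj_iff _ _).1 (hstep i)
  omega

/-- `X + Y` is constant mod 2 along a brick path. [cite: Grimmett2018, §5.5 (the sublattice X ≡ Y (mod 2))] -/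
theorem parity_eq (hstep : ∀ i, brickGraph.Adj (v i) (v (i + 1))) (i : ℕ) :
    (v i 0 + v i 1) % 2 = (v 0 0 + v 0 1) % 2 := by
  induction i with
  | zero => rfl
  | succ n ih =>
    have h := (brickGraph_adj_iff _ _).1 (hstep n)
    omega

/-- Two sites of a brick path in the same row differ by an even amount in `X`. [cite: Grimmett2018, §5.5] -/
theorem even_sub_of_row_eq (hstep : ∀ i, brickGraph.Adj (v i) (v (i + 1))) {a b : ℕ} (h : v a 1 = v b 1) :
    (v a 0 - v b 0) % 2 = 0 := by
  have ha := parity_eq hstep a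
  have hb := parity_eq hstep b
  omega

/-- Discrete intermediate value property of the rows, inductive form (every row between the rows of `v a` and `v (a+n)` is the row
of some `v c`, `a ≤ c ≤ a + n`). [folklore] -/
private theorem exists_row_eq_of_between (hstep : ∀ i, brickGraph.Adj (v i) (v (i + 1))) (a : ℕ) :
    ∀ (n : ℕ) {y : ℤ}, (v a 1 ≤ y ∧ y ≤ v (a + n) 1) ∨ (v (a + n) 1 ≤ y ∧ y ≤ v a 1) →
      ∃ c, a ≤ c ∧ c ≤ a + n ∧ v c 1 = y := by
  intro n
  induction n with
  | zero =>
    intro y hy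
    simp only [Nat.add_zero] at hy
    exact ⟨a, le_rfl, by omega, by omega⟩
  | succ n ih =>
    intro y hy
    simp only [← Nat.add_assoc] at hy ⊢
    have hs := row_step_le hstep (a + n)
    by_cases h : (v a 1 ≤ y ∧ y ≤ v (a + n) 1) ∨ (v (a + n) 1 ≤ y ∧ y ≤ v a 1)
    · obtain ⟨c, hc1, hc2, hc3⟩ := ih h
      exact ⟨c, hc1, by omega, hc3⟩
    · exact ⟨a + n + 1, by omega, le_rfl, by omega⟩

/-- **Discrete intermediate value property of the rows of a brick path**: every row between the rows of `v a` and `v c` (`a ≤ c`)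
is the row of some `v b`, `a ≤ b ≤ c` — a brick step changes the row `Y` by at most one.
[cite: Grimmett2018, §5.5 (brick coordinates of 𝕋: the steps (±2,0), (±1,±1))] -/
theorem exists_row_eq (hstep : ∀ i, brickGraph.Adj (v i) (v (i + 1))) {a c : ℕ} (hac : a ≤ c) {y : ℤ}
    (hy : (v a 1 ≤ y ∧ y ≤ v c 1) ∨ (v c 1 ≤ y ∧ y ≤ v a 1)) : ∃ b, a ≤ b ∧ b ≤ c ∧ v b 1 = y := by
  obtain ⟨n, rfl⟩ := Nat.exists_eq_add_of_le hac
  exact exists_row_eq_of_between hstep a n hy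

/-! ### Uniqueness of the row-separated equal-split cut -/

/-- Core case: a cut at `0` excludes a cut at any `0 < j < 2N`.  Two cuts would differ by arcs lying in disjoint row intervals on the two
sides of the junction rows, which puts both junctions on the same pair of rows, where the left/right order of the four junction sites is
contradictory. [cite: Hammond2015SAPJoining, §4.2 (arXiv v5 pp. 20–24: global join plaquettes; here unique, for row-separated joins)] -/
theorem not_isRowSepCut_of_zero (hN : 1 ≤ N) (hper : ∀ i, v (i + 2 * N) = v i)
    (hstep : ∀ i, brickGraph.Adj (v i) (v (i + 1))) (h0 : IsRowSepCut N v 0) {j : ℕ} (hj0 : 0 < j) (hj : j < 2 * N)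
    (hj' : IsRowSepCut N v j) : False := by
  have hperc : ∀ i k, v (i + 2 * N) k = v i k := fun i k => by rw [hper]
  obtain ⟨⟨hq1, hq0⟩, ⟨hw1, hw0⟩, ⟨hu1, hu0⟩, sep0⟩ := h0
  obtain ⟨⟨hq1', hq0'⟩, ⟨hw1', hw0'⟩, ⟨hu1', hu0'⟩, sepj⟩ := hj'
  simp only [Nat.zero_add] at hq1 hq0 hw1 hw0 hu1 hu0
  have h2N : v (2 * N) 0 = v 0 0 ∧ v (2 * N) 1 = v 0 1 :=
    ⟨by simpa using hperc 0 0, by simpa using hperc 0 1⟩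
  have h3N : v (3 * N - 1) 0 = v (N - 1) 0 ∧ v (3 * N - 1) 1 = v (N - 1) 1 := by
    have e : 3 * N - 1 = (N - 1) + 2 * N := by omega
    rw [e]; exact ⟨hperc _ 0, hperc _ 1⟩
  rcases Nat.lt_trichotomy j N with hjN | hjeq | hjN
  · -- Case `0 < j < N`: the arcs `A = v[0, j)` and `B = v[N, j+N)` change sides between the two cuts.
    have claimA : ∀ a, a < j → v a 1 ≠ v N 1 := by
      intro a ha hrow
      have h1 := sep0 a N (Nat.zero_le _) (by omega) (by omega) (by omega) hrow
      have h2 := sepj N (a + 2 * N) (by omega) (by omega) (by omega) (by omega) (by rw [hperc]; exact hrow.symm)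
      rw [hperc] at h2
      omega
    have claimB : ∀ b, N ≤ b → b < j + N → v b 1 ≠ v 0 1 := by
      intro b hb1 hb2 hrow
      have h1 := sep0 0 b (Nat.zero_le _) (by omega) (by omega) (by omega) hrow.symm
      have h2 := sepj b (2 * N) (by omega) (by omega) (by omega) (by omega) (by rw [h2N.2]; exact hrow)
      rw [h2N.1] at h2
      omega
    -- `A` stays weakly on `p`'s side of the junction rows, `B` weakly on `u`'s side (intermediate value property)
    have hA : ∀ a, a < j →
        (v (N - 1) 1 = v 0 1 + 1 → v a 1 ≤ v 0 1) ∧ (v (N - 1) 1 + 1 = v 0 1 → v 0 1 ≤ v a 1) := by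
      intro a ha
      refine ⟨fun hd => ?_, fun hd => ?_⟩
      · by_contra hcon
        push Not at hcon
        obtain ⟨c, -, hc2, hc3⟩ := exists_row_eq hstep (Nat.zero_le a) (y := v N 1) (by omega)
        exact claimA c (by omega) hc3
      · by_contra hcon
        push Not at hcon
        obtain ⟨c, -, hc2, hc3⟩ := exists_row_eq hstep (Nat.zero_le a) (y := v N 1) (by omega)
        exact claimA c (by omega) hc3
    have hB : ∀ b, N ≤ b → b < j + N →
        (v (N - 1) 1 = v 0 1 + 1 → v N 1 ≤ v b 1) ∧ (v (N - 1) 1 + 1 = v 0 1 → v b 1 ≤ v N 1) := by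
      intro b hb1 hb2
      refine ⟨fun hd => ?_, fun hd => ?_⟩
      · by_contra hcon
        push Not at hcon
        obtain ⟨c, hc1, hc2, hc3⟩ := exists_row_eq hstep hb1 (y := v 0 1) (by omega)
        exact claimB c hc1 (by omega) hc3
      · by_contra hcon
        push Not at hcon
        obtain ⟨c, hc1, hc2, hc3⟩ := exists_row_eq hstep hb1 (y := v 0 1) (by omega)
        exact claimB c hc1 (by omega) hc3
    -- hence the second junction sits on the same two rows as the first
    have hqrow : v (j + 2 * N - 1) 1 = v (j - 1) 1 := by
      have e : j + 2 * N - 1 = (j - 1) + 2 * N := by omega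
      rw [e, hperc]
    have hA' := hA (j - 1) (by omega)
    have hB' := hB (j + N - 1) (by omega) (by omega)
    have hpj : v j 1 = v 0 1 := by
      rcases hu1 with h | h <;> rcases hu1' with h' | h' <;> omega
    have huj : v (j + N - 1) 1 = v (N - 1) 1 := by
      rcases hu1 with h | h <;> rcases hu1' with h' | h' <;> omega
    -- and the left/right order of `p' , p` (row of `p`) and of `u, u'` (row of `u`) is contradictory
    have hx1 := sepj j (2 * N) le_rfl (by omega) (by omega) (by omega) (by rw [h2N.2]; exact hpj)
    rw [h2N.1] at hx1
    have hx2 := sep0 (N - 1) (j + N - 1) (Nat.zero_le _) (by omega) (by omega) (by omega) huj.symm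
    have hpar1 := even_sub_of_row_eq hstep hpj
    have hpar2 := even_sub_of_row_eq hstep huj
    rcases hu0 with h | h <;> rcases hu0' with h' | h' <;> omega
  · -- Case `j = N`: the right arc of the cut at `N` starts at `v (2N) = p`, which lies RIGHT of `q = v (2N-1)` in its row.
    have h := sepj (2 * N - 1) (2 * N) (by omega) (by omega) (by omega) (by omega) (by rw [h2N.2]; exact hq1)
    rw [h2N.1] at h
    omega
  · -- Case `N < j < 2N`: now the arcs `v[j-N, N)` and `v[j, 2N)` change sides.
    have claimC : ∀ c, j - N ≤ c → c < N → v c 1 ≠ v (2 * N - 1) 1 := by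
      intro c hc1 hc2 hrow
      have h1 := sep0 c (2 * N - 1) (Nat.zero_le _) (by omega) (by omega) (by omega) hrow
      have h2 := sepj (2 * N - 1) (c + 2 * N) (by omega) (by omega) (by omega) (by omega)
        (by rw [hperc]; exact hrow.symm)
      rw [hperc] at h2
      omega
    have claimD : ∀ t, j ≤ t → t < 2 * N → v t 1 ≠ v (N - 1) 1 := by
      intro t ht1 ht2 hrow
      have h1 := sep0 (N - 1) t (Nat.zero_le _) (by omega) (by omega) (by omega) hrow.symm
      have h2 := sepj t (3 * N - 1) ht1 (by omega) (by omega) (by omega) (by rw [h3N.2]; exact hrow)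
      rw [h3N.1] at h2
      omega
    have hC : ∀ c, j - N ≤ c → c < N →
        (v (N - 1) 1 = v 0 1 + 1 → v (N - 1) 1 ≤ v c 1) ∧ (v (N - 1) 1 + 1 = v 0 1 → v c 1 ≤ v (N - 1) 1) := by
      intro c hc1 hc2
      refine ⟨fun hd => ?_, fun hd => ?_⟩
      · by_contra hcon
        push Not at hcon
        obtain ⟨c', hc1', hc2', hc3'⟩ :=
          exists_row_eq hstep (show c ≤ N - 1 by omega) (y := v (2 * N - 1) 1) (by omega)
        exact claimC c' (by omega) (by omega) hc3'
      · by_contra hcon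
        push Not at hcon
        obtain ⟨c', hc1', hc2', hc3'⟩ :=
          exists_row_eq hstep (show c ≤ N - 1 by omega) (y := v (2 * N - 1) 1) (by omega)
        exact claimC c' (by omega) (by omega) hc3'
    have hD : ∀ t, j ≤ t → t < 2 * N →
        (v (N - 1) 1 = v 0 1 + 1 → v t 1 ≤ v 0 1) ∧ (v (N - 1) 1 + 1 = v 0 1 → v 0 1 ≤ v t 1) := by
      intro t ht1 ht2
      refine ⟨fun hd => ?_, fun hd => ?_⟩
      · by_contra hcon
        push Not at hcon
        obtain ⟨t', ht1', ht2', ht3'⟩ :=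
          exists_row_eq hstep (show t ≤ 2 * N - 1 by omega) (y := v (N - 1) 1) (by omega)
        exact claimD t' (by omega) (by omega) ht3'
      · by_contra hcon
        push Not at hcon
        obtain ⟨t', ht1', ht2', ht3'⟩ :=
          exists_row_eq hstep (show t ≤ 2 * N - 1 by omega) (y := v (N - 1) 1) (by omega)
        exact claimD t' (by omega) (by omega) ht3'
    have hwrow : v (j + N) 1 = v (j - N) 1 := by
      have e : j + N = (j - N) + 2 * N := by omega
      rw [e, hperc]
    have hD' := hD j le_rfl hj
    have hC' := hC (j - N) le_rfl (by omega)
    have hpj : v j 1 = v 0 1 := by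
      rcases hu1 with h | h <;> rcases hu1' with h' | h' <;> omega
    have huj : v (j + N - 1) 1 = v (N - 1) 1 := by
      rcases hu1 with h | h <;> rcases hu1' with h' | h' <;> omega
    have hx1 := sep0 0 j (Nat.zero_le _) (by omega) (by omega) (by omega) hpj.symm
    have hx2 := sepj (j + N - 1) (3 * N - 1) (by omega) (by omega) (by omega) (by omega) (by rw [h3N.2]; exact huj)
    rw [h3N.1] at hx2
    have hpar1 := even_sub_of_row_eq hstep hpj
    have hpar2 := even_sub_of_row_eq hstep huj
    rcases hu0 with h | h <;> rcases hu0' with h' | h' <;> omega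

/-- Re-indexing: a cut of `v` at `c + j` is a cut of the re-rooted sequence `v (· + c)` at `j` (the junction does not depend on where
the joined polygon is read from). [cite: Hammond2015SAPJoining, Definition 4.3 (arXiv v5 p. 20: the junction plaquette of the join polygon)] -/
theorem isRowSepCut_shift {c j : ℕ} (hN : 1 ≤ N) (h : IsRowSepCut N v (c + j)) :
    IsRowSepCut N (fun i => v (i + c)) j := by
  obtain ⟨⟨hq1, hq0⟩, ⟨hw1, hw0⟩, ⟨hu1, hu0⟩, sep⟩ := h
  have e1 : j + 2 * N - 1 + c = c + j + 2 * N - 1 := by omega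
  have e2 : j + N + c = c + j + N := by omega
  have e3 : j + N - 1 + c = c + j + N - 1 := by omega
  have e4 : j + c = c + j := by omega
  refine ⟨?_, ?_, ?_, ?_⟩
  · show v (j + 2 * N - 1 + c) 1 = v (j + c) 1 ∧ v (j + 2 * N - 1 + c) 0 = v (j + c) 0 + 2
    rw [e1, e4]; exact ⟨hq1, hq0⟩
  · show v (j + N + c) 1 = v (j + N - 1 + c) 1 ∧ v (j + N + c) 0 = v (j + N - 1 + c) 0 + 2
    rw [e2, e3]; exact ⟨hw1, hw0⟩
  · show (v (j + N - 1 + c) 1 = v (j + c) 1 + 1 ∨ v (j + N - 1 + c) 1 + 1 = v (j + c) 1) ∧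
      (v (j + N - 1 + c) 0 = v (j + c) 0 + 1 ∨ v (j + N - 1 + c) 0 + 1 = v (j + c) 0)
    rw [e3, e4]; exact ⟨hu1, hu0⟩
  · intro a b ha1 ha2 hb1 hb2 hrow
    exact sep (a + c) (b + c) (by omega) (by omega) (by omega) (by omega) hrow

/-- **The row-separated equal-split cut of a joined polygon is unique.**  For a `2N`-periodic sequence of brick sites with adjacent
consecutive sites (the joined `2N`-gon read cyclically), two row-separated equal-split cuts `j₁, j₂ < 2N` coincide: the junction rhombus —
hence the two halves — is determined by the joined polygon (the decoding step of a row-separated Madras join on `𝕋`).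
[cite: Hammond2015SAPJoining, Definition 4.3 and §4.2 (arXiv v5 pp. 20–24: junction plaquette; global join plaquettes and their enumeration)]
[cite: Madras1995LatticeAnimalsExponent, §2 (primary, not held)] [cite: MadrasSlade1993, Theorem 3.2.3 proof (p. 64–65: extremal-bond decoding of
polygon concatenation)] — the row-separation uniqueness invariant is not located in print — NEW-IN-WRITING (modest), technique class Madras join
(lit-2 g16, 2026-08-23). -/
theorem isRowSepCut_unique (hN : 1 ≤ N) (hper : ∀ i, v (i + 2 * N) = v i)
    (hstep : ∀ i, brickGraph.Adj (v i) (v (i + 1))) {j₁ j₂ : ℕ} (hj₁ : j₁ < 2 * N) (hj₂ : j₂ < 2 * N)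
    (h₁ : IsRowSepCut N v j₁) (h₂ : IsRowSepCut N v j₂) : j₁ = j₂ := by
  by_contra hne
  have key : ∀ {a b : ℕ}, a < b → b < 2 * N → IsRowSepCut N v a → IsRowSepCut N v b → False := by
    intro a b hab hb ha hb'
    have hper' : ∀ i, (fun i => v (i + a)) (i + 2 * N) = (fun i => v (i + a)) i := by
      intro i
      show v (i + 2 * N + a) = v (i + a)
      have e : i + 2 * N + a = (i + a) + 2 * N := by omega
      rw [e, hper]
    have hstep' : ∀ i, brickGraph.Adj ((fun i => v (i + a)) i) ((fun i => v (i + a)) (i + 1)) := by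
      intro i
      show brickGraph.Adj (v (i + a)) (v (i + 1 + a))
      have e : i + 1 + a = (i + a) + 1 := by omega
      rw [e]; exact hstep _
    have h0 : IsRowSepCut N (fun i => v (i + a)) 0 :=
      isRowSepCut_shift hN (by simpa using ha)
    have hb'' : IsRowSepCut N (fun i => v (i + a)) (b - a) :=
      isRowSepCut_shift hN (by rw [Nat.add_sub_cancel' hab.le]; exact hb')
    exact not_isRowSepCut_of_zero hN hper' hstep' h0 (by omega) (by omega) hb''
  rcases Nat.lt_or_gt_of_ne hne with h | h
  · exact key h hj₂ h₁ h₂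
  · exact key h hj₁ h₂ h₁

end TriPolygon

end Literature.Probability.RandomPlanarGeometry.SAW

end
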